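import Literature.MathematicalPhysics.QuantumFieldTheory.BalabanImbrieJaffe1984to88.BIJ85MeanFieldAction41

/-!
# `BalabanImbrieJaffe1984to88.BIJ85Eq632MeanFieldAction` — T. Bałaban, J. Imbrie, A. Jaffe, *Renormalization of the Higgs model: minimizers,
propagators and the stability of mean field theory*, Commun. Math. Phys. **97** (1985) 299–329 [BalabanImbrieJaffe1985], **(6.3.2)** p. 320:
THE GAUGE INVARIANCE OF THE MEAN FIELD ACTION (4.1) — proved for the `S_k` OF RECORD `BIJ85MeanFieldAction41.meanFieldAction`.

statement-level skeleton of published theorems with citation tags; proofs where landed; nothing here is a claim about the Yang–Mills mass gap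

PDF held: `paper:balaban1985-cmp97-bij-higgs-minimizers` (journal page = PDF page + 298); p. 320 [PDF 22] read on the text layer this session
(`lit read … --pages 21-22`).

CITATION HEADER (lean-in-tree rule).  Part of the lit-balaban TYPED SKELETON (HOME `run/shared/lean/pub/lit-balaban/`), unit `lit-balaban-r13`
gen 96 (free-target protocol G.5-34(d): target (ν) of the row owner r15 g16's «TWO FREE S TARGETS» 2026-08-23T13:26:52Z, lead g12 HEAD WORDS
Q33).  Serves row `C1.Eq6.3.1-6.3.4` of `HOME/lit-balaban-r15/ROWS-C1.md` (display (6.3.2); (6.3.1)/(6.3.3)/(6.3.4) are the surrounding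
decomposition / integral displays and are not restated here).

THE PRINTED TEXT.  p. 320 [PDF 22] (page render `HOME/lit-balaban-r15/pages/1985-cmp97-bij-higgs-minimizers-p022-x2.png` read this session),
verbatim: *"This gauge transformation does not influence the gauge field quadratic form σ_k, since this form is fully gauge invariant. More
generally, expressions involving only the gauge field are gauge invariant, so we must discuss the scalar field part of the action. In that case,
the form Δ_k(u_k) does depend on the gauge transformation ω. Our procedure for constructing S_k has the general invariance
S_k(u_ke^{−iη∂λ}, e^{iλ}φ) = S′_k(u_k, φ) (6.3.2) for a gauge transformation λ. While we do not prove this invariance here, it is clear in the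
case of the quadratic forms for which we write explicit formulas. The scalar field integral has the form ∫𝒟φ exp{−[S_k(u_k, φ) +
½a‖ψ − Q(u_k)φ‖²]}. (6.3.3)"*.  READING OF RECORD (row owner r15 g16, lead g12 HEAD WORDS Q33, 2026-08-23): print's right-hand side of (6.3.2)
carries a prime, `S′_k`; it is read `S_k` — the INVARIANCE of the one functional `S_k` that the two surrounding sentences name (*"the general
invariance"*, *"this invariance"*) and that the step (6.3.3) → (6.3.4) uses; the unprimed equality is what is proved below.

WHAT IS PROVED (theorems; one index map and two level-transport kernels are definitions with bodies; no `Prop`-valued fact).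
* **`meanFieldAction_gaugeIdx`** — (6.3.2) for THE `S_k` OF RECORD, the mean field action (4.1)
  `meanFieldAction a ha i ψ = ½⟨f^{(k)}, σ_kf^{(k)}⟩ + ½⟨ψ, Δ_k(u_k)ψ⟩` of r15's `BIJ85MeanFieldAction41` at an index `i` of ALL actual Sect. 7.3
  data (p33's `BIJ85Claim73AllCouplings.AllIdx`: a torus, a scale `1 ≤ k ≤ m + K`, a coupling `0 < e_k ≤ 1`, a unit-lattice `U(1)` field `v` on
  `T₁^{(k)}`): for every `U(1)` gauge transformation `g` of the unit lattice `T₁^{(k)}` and every `ψ`,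
  `meanFieldAction a ha (gaugeIdx i g) ψ′ = meanFieldAction a ha i ψ`, where `gaugeIdx i g` replaces `v` by `v^g` ((2.7):
  `BIJ85Sect1Model.gaugeU g v`, `= v·e^{−i∂λ}` at `g = e^{iλ}` by p30's `BIJ85Rem317Torus.gaugeU_exp_eq_translate62`, kernel `gaugeIdx_exp_v`)
  and `ψ′(y) = g(y)ψ(y)`; **`eq632_meanFieldAction`** is the same statement in print's letters `λ`, `e^{iλ}φ`.
* The MECHANISM, by name, exactly as the row owner located it: the gauge term — every plaquette field is gauge invariant (p30's
  `plaqField_gaugeU`), so `f^{(k)}` and `½⟨f^{(k)}, σ_kf^{(k)}⟩` are unchanged (`fk_gaugeIdx`, `gaugePart_gaugeIdx`; print: *"σ_k … is fully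
  gauge invariant"*); the background — **`actualBgU1_gaugeU`** / **`U_gaugeIdx`**: the actual background (4.5.4) is gauge COVARIANT,
  `u_k(v^g) = (u_k(v))^{g∘B^k}` with the block-constant gauge transformation `g∘B^k` of the `η`-lattice (p31's (4.17) covariance of the pull-back
  `BIJ85Eq453GaugeField.qsstarGIter_gaugeAct` on p33's form `BIJ85Claim73SecondForm.actualBgU1_eq` of (4.5.4); the phase factor
  `exp[−ie_kη𝒟_k∂^*Q^{e*}_kf^{(k)}]` depends on `v` through `f^{(k)}` only and `U(1)` is abelian) — so print's `u_ke^{−iη∂λ̃}` is realised with the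
  `η`-lattice gauge function `λ̃ = λ∘B^k`; the scalar term — p11's (6.3.2) for the explicit scalar form,
  `BIJ85ScalarPropagatorTorusK.inner_deltaOp_gaugeAct` (`⟨hψ, Δ_k(u^h)hψ⟩ = ⟨ψ, Δ_k(u)ψ⟩` for ANY right inverses `G_k`, `G′_k` — it therefore
  fits THE inverse `allG` (4.6.2) chosen at both indices), the `η`-lattice transformation `h = g∘B^k` read at the corner points being `g` itself
  (`blkIter_cornerIter`): `deltaForm_gaugeIdx`.
HONEST SCOPE.  (6.3.2) is printed for *"a gauge transformation λ"* of the `η`-lattice acting on the pair `(u_k, φ)`; the `S_k` of record is a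
function of the unit-lattice data `v` (through `u_k = u_k(v)` and `f^{(k)}`), on which the gauge group of `T₁^{(k)}` acts, and the
`η`-lattice transformations so induced on `u_k` are the block-constant ones `λ∘B^k` — this is the typed content of the row; the general
`(u, h)` mechanism for the scalar form is p11's theorem cited above, and the gauge-field form's invariance under every `η`-lattice `λ` is
p30's `BIJ85Rem317Torus.eq632_gaugeForm`.  The «interaction terms» of (4.1) are not an object of this paper (*"considered in detail in a
later paper"*) and are not typed, as in `BIJ85MeanFieldAction41`.  Imports: Literature + Mathlib only; standard axioms.
-/

namespace Literature.MathematicalPhysics.QuantumFieldTheory.BalabanImbrieJaffe1984to88.BIJ85Eq632MeanFieldAction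

open Literature.MathematicalPhysics.QuantumFieldTheory.Balaban1983to89 hiding Site Plaq
open Balaban1983to89 renaming Site → TSite
open B7SectAStatements (blockOfIter)
open LatticeFieldCalculus (grad)
open BIJ88Sect3Statements (U1 toC toC_mul)
open BIJ88Sect3Rescaling (toC_injective_U1 fieldEquiv fieldEquiv_apply circleEquivU1 toC_circleEquivU1)
open BIJ85Sect1Model (U1Field gaugeU)
open BIJ85SmallFieldSplit64 (plaqField expField translate62)
open BIJ85Rem317Torus (plaqField_gaugeU gaugeU_exp_eq_translate62)
open BIJ85BlockAveragesTorus (toC_inv')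
open BIJ85BlockAveragesTorusK (CoarseSpK cornerIter blkIter blkIter_cornerIter)
open BIJ85Ineq732Background (blkIter_eq_blockOfIter)
open BIJ85Eq453GaugeField (qsstarGIter qsstarGIter_gaugeAct)
open BIJ85Eq454PlaqResidual (actualBgU1)
open BIJ85Claim73SecondForm (lvl vK actualBgU1_eq)
open BIJ85Claim73AllCouplings (AllIdx allStabData allG allG_spec)
open BIJ85ScalarPropagatorTorusK (inner_deltaOp_gaugeAct)
open BIJ85Ineq732Flat (cPhys)
open BIJ85MeanFieldAction41 (fk sigmaK gaugePart scalarPart meanFieldAction)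
open scoped BigOperators RealInnerProductSpace
open Complex

noncomputable section

variable {P : Params}

/-! ## §1  Level transport: the unit lattice `T₁^{(k)}` as the level `0 + k` of the scalar-field files -/

/-- kernel: a site of the level `0 + k` of the Sect. 4.6 / 7.3 scalar-field files read as a site of `T₁^{(k)}` (`Site P (0 + k)` and `Site P k`
are equal, not definitionally; the cast of p33's `BIJ85LineSumHk.cast_blkIter`). [cite: BalabanImbrieJaffe1985, (2.1) p.302] -/
def siteK (k : ℕ) (y : TSite P (0 + k)) : TSite P k := cast (congrArg (TSite P) (Nat.zero_add k)) y

/-- **a `U(1)` gauge transformation `g` of the unit lattice `T₁^{(k)}`** ((2.7): `g : T₁^{(k)} → U(1)`) read on the `U1` carrier of the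
scalar-field files at the level `0 + k`. [cite: BalabanImbrieJaffe1985, (2.7) p.303] -/
def transfK (k : ℕ) (g : TSite P k → Circle) : GaugeTransf P (0 + k) U1 := fun y => circleEquivU1 (g (siteK k y))

/-- kernel: the value of `transfK k g` at `y`, read in `ℂ`, is `g(y)`. [cite: BalabanImbrieJaffe1985, (2.7) p.303] -/
@[simp] theorem toC_transfK (k : ℕ) (g : TSite P k → Circle) (y : TSite P (0 + k)) :
    toC (transfK k g y) = (g (siteK k y) : ℂ) := by
  rw [transfK, toC_circleEquivU1]

/-- kernel: the carrier dictionary `Circle → U1` carries the gauge action (2.7) `(v^g)_b = g(b₋)g(b₊)^{−1}v_b` to `GaugeField.gaugeAct`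
(`U(1)` abelian), along any equality of levels. [cite: BalabanImbrieJaffe1985, (2.7) p.303] -/
theorem lvl_fieldEquiv_gaugeU {n n' : ℕ} (e : n = n') (g : TSite P n → Circle) (v : U1Field P n) :
    lvl e (fieldEquiv (gaugeU g v)) =
      GaugeField.gaugeAct (fun y => circleEquivU1 (g (cast (congrArg (TSite P) e.symm) y))) (lvl e (fieldEquiv v)) := by
  subst e
  show fieldEquiv (gaugeU g v) = GaugeField.gaugeAct (fun y => circleEquivU1 (g y)) (fieldEquiv v)
  funext b
  apply toC_injective_U1
  simp only [GaugeField.gaugeAct, fieldEquiv_apply, toC_mul, toC_inv', toC_circleEquivU1, gaugeU, Circle.coe_mul,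
    Circle.coe_inv]
  ring

/-- kernel: the same at one level — p34's configuration dictionary `fieldEquiv : U1Field ≃ GaugeField · U1` intertwines r15's `gaugeU` (2.7) with
`GaugeField.gaugeAct` (the form in which r18's `JointInvariant` / `IsRT311` quantify over gauge transformations). [cite: BalabanImbrieJaffe1985, (2.7) p.303] -/
theorem fieldEquiv_gaugeU {n : ℕ} (g : TSite P n → Circle) (v : U1Field P n) :
    fieldEquiv (gaugeU g v) = GaugeField.gaugeAct (fun y => circleEquivU1 (g y)) (fieldEquiv v) :=
  lvl_fieldEquiv_gaugeU rfl g v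

/-- **the unit-lattice field `v^g` on the `U1` carrier is `(vK k v)^{g}`** (p33's `vK`, the gauge transformation read at the level `0 + k`).
[cite: BalabanImbrieJaffe1985, (2.7) p.303] -/
theorem vK_gaugeU (k : ℕ) (g : TSite P k → Circle) (v : U1Field P k) :
    vK k (gaugeU g v) = GaugeField.gaugeAct (transfK k g) (vK k v) :=
  lvl_fieldEquiv_gaugeU (Nat.zero_add k).symm g v

/-- kernel: the block-constant `η`-lattice transformation `g∘B^k` read at the corner point of `y ∈ T₁^{(k)}` is `g(y)` (p11's
`blkIter_cornerIter`; standing range). [cite: BalabanImbrieJaffe1985, (2.4) p.302] -/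
theorem transfK_blockOfIter_cornerIter {k : ℕ} (hk : 0 + k ≤ P.m + P.K) (g : TSite P k → Circle) (y : TSite P (0 + k)) :
    transfK k g (blockOfIter k (cornerIter k y)) = transfK k g y := by
  rw [← blkIter_eq_blockOfIter, blkIter_cornerIter k hk]

/-! ## §2  The actual background (4.5.4) is gauge covariant: `u_k(v^g) = (u_k(v))^{g∘B^k}` -/

/-- **GAUGE COVARIANCE OF THE ACTUAL BACKGROUND (4.5.4)**: `u_k(v^g) = (u_k(v))^{g∘B^k}` — for every `U(1)` gauge transformation `g` of the
unit lattice `T₁^{(k)}`, the background `u_k = (Q^{s*}_kv)·exp[−ie_kη𝒟_k∂^*Q^{e*}_kf^{(k)}]` computed from `v^g` is the gauge transform of the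
one computed from `v` by the block-constant `η`-lattice transformation `x ↦ g(B^k(x))`: the pull-back is covariant (p31's `qsstarGIter_gaugeAct`,
(4.17) of [BalabanImbrieJaffe1988]) and the phase factor depends on `v` only through the gauge-invariant `f^{(k)}` (p30's `plaqField_gaugeU`)
— print's `u_k ↦ u_ke^{−iη∂λ̃}` of (6.3.2) with `λ̃ = λ∘B^k` (standing range `k ≤ m + K`, `2 ≤ d`). [cite: BalabanImbrieJaffe1985, (6.3.2) p.320] -/
theorem actualBgU1_gaugeU (hd : 2 ≤ P.d) {k : ℕ} (hk : 0 + k ≤ P.m + P.K) (e : ℝ) (g : TSite P k → Circle) (v : U1Field P k) :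
    actualBgU1 hd k e (gaugeU g v) = GaugeField.gaugeAct (fun x => transfK k g (blockOfIter k x)) (actualBgU1 hd k e v) := by
  have hpf : plaqField e (gaugeU g v) = plaqField e v := funext fun p => plaqField_gaugeU e g v p
  rw [actualBgU1_eq, actualBgU1_eq, hpf, vK_gaugeU, qsstarGIter_gaugeAct k hk]
  funext b
  apply toC_injective_U1
  simp only [GaugeField.gaugeAct, toC_mul, toC_inv']
  ring

/-! ## §3  The gauge group of `T₁^{(k)}` acting on the index of all actual data -/

variable {d L : ℕ}

/-- **the gauge transformation (2.7) of the data**: the index `i` with its unit-lattice field `v` replaced by `v^g`,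
`(v^g)_b = g(b₋)g(b₊)^{−1}v_b` (`gaugeU`; `= v·e^{−i∂λ}` for `g = e^{iλ}`, `gaugeIdx_exp_v`) — torus, scale and coupling unchanged.
[cite: BalabanImbrieJaffe1985, (2.7) p.303] -/
def gaugeIdx (i : AllIdx d L) (g : TSite i.P i.k → Circle) : AllIdx d L := { i with v := gaugeU g i.v }

/-- kernel: the field of the transformed index. [cite: BalabanImbrieJaffe1985, (2.7) p.303] -/
@[simp] theorem gaugeIdx_v (i : AllIdx d L) (g : TSite i.P i.k → Circle) : (gaugeIdx i g).v = gaugeU g i.v := rfl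

/-- kernel, print's letters: for `g = e^{iλ}` the transformed field is `v·e^{−i∂λ}` (unit lattice: `η = 1`, `∂ = grad 1`; p30's
`gaugeU_exp_eq_translate62`). [cite: BalabanImbrieJaffe1985, (6.3.2) p.320] -/
theorem gaugeIdx_exp_v (i : AllIdx d L) (lam : TSite i.P i.k → ℝ) :
    (gaugeIdx i fun y => Circle.exp (lam y)).v = translate62 i.v (expField (-1) (grad 1 lam)) :=
  gaugeU_exp_eq_translate62 1 1 (by norm_num) lam i.v

/-- **`f^{(k)}` is gauge invariant** ((4.2.4) is a plaquette field; p30's `plaqField_gaugeU`). [cite: BalabanImbrieJaffe1985, (6.3.2) p.320] -/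
theorem fk_gaugeIdx (i : AllIdx d L) (g : TSite i.P i.k → Circle) : fk (gaugeIdx i g) = fk i := by
  have hpf : plaqField i.e (gaugeU g i.v) = plaqField i.e i.v := funext fun p => plaqField_gaugeU i.e g i.v p
  show BIJ85Sigma421Torus.toU i.P i.k (plaqField i.e (gaugeU g i.v)) = BIJ85Sigma421Torus.toU i.P i.k (plaqField i.e i.v)
  rw [hpf]

/-- **the gauge-field part `½⟨f^{(k)}, σ_kf^{(k)}⟩` is gauge invariant** — p. 320: *"the gauge field quadratic form σ_k … is fully gauge
invariant"*. [cite: BalabanImbrieJaffe1985, (6.3.2) p.320] -/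
theorem gaugePart_gaugeIdx (i : AllIdx d L) (g : TSite i.P i.k → Circle) : gaugePart (gaugeIdx i g) = gaugePart i := by
  show (1 / 2 : ℝ) * ⟪fk (gaugeIdx i g), sigmaK (gaugeIdx i g) (fk (gaugeIdx i g))⟫ = (1 / 2 : ℝ) * ⟪fk i, sigmaK i (fk i)⟫
  rw [fk_gaugeIdx]
  rfl

/-- **the actual background of the transformed data is `(u_k)^{g∘B^k}`** (`actualBgU1_gaugeU` at the index).
[cite: BalabanImbrieJaffe1985, (6.3.2) p.320] -/
theorem U_gaugeIdx (i : AllIdx d L) (g : TSite i.P i.k → Circle) :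
    (gaugeIdx i g).U = GaugeField.gaugeAct (fun x => transfK i.k g (blockOfIter i.k x)) i.U :=
  actualBgU1_gaugeU i.hd2 i.hk0 i.e g i.v

/-- **(6.3.2) for the scalar part `⟨ψ, Δ_k(u_k)ψ⟩` of (4.1) at the actual data**: `⟨gψ, Δ_k(u_k(v^g))(gψ)⟩ = ⟨ψ, Δ_k(u_k(v))ψ⟩` — the background
is `(u_k)^{g∘B^k}` (`U_gaugeIdx`), `g∘B^k` read at the corner points is `g`, and p11's `inner_deltaOp_gaugeAct` ((6.3.2) for the explicit scalar
form, valid for any right inverses of the two operators `D^*D + a_kQ_k^*Q_k`, hence for THE inverse (4.6.2) `allG` chosen at either index).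
[cite: BalabanImbrieJaffe1985, (6.3.2) p.320] -/
theorem deltaForm_gaugeIdx (a : ℝ) (ha : 0 < a) (i : AllIdx d L) (g : TSite i.P i.k → Circle) {ψ ψ' : CoarseSpK i.P 0 i.k}
    (hψ' : ∀ y, ψ' y = (g (siteK i.k y) : ℂ) * ψ y) :
    (allStabData a ha (gaugeIdx i g)).deltaForm ψ' = (allStabData a ha i).deltaForm ψ := by
  have hG' := allG_spec a ha (gaugeIdx i g)
  rw [U_gaugeIdx] at hG'
  have hψ'' : ∀ y, ψ' y = toC (transfK i.k g (blockOfIter i.k (cornerIter i.k y))) * ψ y := fun y => by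
    rw [transfK_blockOfIter_cornerIter i.hk0, toC_transfK, hψ' y]
  show ⟪ψ', BIJ85ScalarForm464.deltaOp (BIJ85BlockAveragesTorusK.QlinK (gaugeIdx i g).U i.k)
      (BIJ85Sect4Statements.aK a i.P.L i.k) (allG a ha (gaugeIdx i g)) ψ'⟫ =
    ⟪ψ, BIJ85ScalarForm464.deltaOp (BIJ85BlockAveragesTorusK.QlinK i.U i.k) (BIJ85Sect4Statements.aK a i.P.L i.k) (allG a ha i) ψ⟫
  rw [U_gaugeIdx]
  exact inner_deltaOp_gaugeAct i.hk0 (cPhys i.P i.k) (i.aK_pos ha).le _ i.U (allG_spec a ha i) hG' hψ''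

/-- kernel: the scalar part `½⟨ψ, Δ_k(u_k)ψ⟩` at the transformed data and field. [cite: BalabanImbrieJaffe1985, (6.3.2) p.320] -/
theorem scalarPart_gaugeIdx (a : ℝ) (ha : 0 < a) (i : AllIdx d L) (g : TSite i.P i.k → Circle) {ψ ψ' : CoarseSpK i.P 0 i.k}
    (hψ' : ∀ y, ψ' y = (g (siteK i.k y) : ℂ) * ψ y) :
    scalarPart a ha (gaugeIdx i g) ψ' = scalarPart a ha i ψ := by
  show (1 / 2 : ℝ) * (allStabData a ha (gaugeIdx i g)).deltaForm ψ' = (1 / 2 : ℝ) * (allStabData a ha i).deltaForm ψ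
  rw [deltaForm_gaugeIdx a ha i g hψ']

/-! ## §4  (6.3.2) for the mean field action (4.1) -/

/-- **(6.3.2)** p. 320 [PDF 22], verbatim: *"Our procedure for constructing S_k has the general invariance S_k(u_ke^{−iη∂λ}, e^{iλ}φ) =
S′_k(u_k, φ) (6.3.2) for a gauge transformation λ. While we do not prove this invariance here, it is clear in the case of the quadratic forms for
which we write explicit formulas."* (print's prime on the right-hand `S′_k` read `S_k`, the invariance the sentence names — reading of record, see
the module docstring) — PROVED for the explicit quadratic forms, i.e. for THE MEAN FIELD ACTION (4.1) OF RECORD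
`meanFieldAction = ½⟨f^{(k)}, σ_kf^{(k)}⟩ + ½⟨ψ, Δ_k(u_k)ψ⟩`: for every index `i` of all actual data, every `U(1)` gauge transformation `g` of the
unit lattice `T₁^{(k)}` (data `v ↦ v^g`, background `u_k ↦ (u_k)^{g∘B^k} = u_ke^{−iη∂(λ∘B^k)}`) and every `ψ`, with `ψ′ = gψ`:
`S_k(v^g, gψ) = S_k(v, ψ)`. [cite: BalabanImbrieJaffe1985, (6.3.2) p.320] -/
theorem meanFieldAction_gaugeIdx (a : ℝ) (ha : 0 < a) (i : AllIdx d L) (g : TSite i.P i.k → Circle) {ψ ψ' : CoarseSpK i.P 0 i.k}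
    (hψ' : ∀ y, ψ' y = (g (siteK i.k y) : ℂ) * ψ y) :
    meanFieldAction a ha (gaugeIdx i g) ψ' = meanFieldAction a ha i ψ := by
  show gaugePart (gaugeIdx i g) + scalarPart a ha (gaugeIdx i g) ψ' = gaugePart i + scalarPart a ha i ψ
  rw [gaugePart_gaugeIdx, scalarPart_gaugeIdx a ha i g hψ']

/-- the transformed scalar field `gψ` of (6.3.2) (print: `e^{iλ}φ`), `(gψ)(y) = g(y)ψ(y)` on `T₁^{(k)}`. [cite: BalabanImbrieJaffe1985, (6.3.2) p.320] -/
def twistK (k : ℕ) (g : TSite P k → Circle) (ψ : CoarseSpK P 0 k) : CoarseSpK P 0 k :=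
  WithLp.toLp 2 fun y => (g (siteK k y) : ℂ) * ψ y

/-- kernel: the values of `twistK`. [cite: BalabanImbrieJaffe1985, (6.3.2) p.320] -/
@[simp] theorem twistK_apply (k : ℕ) (g : TSite P k → Circle) (ψ : CoarseSpK P 0 k) (y : TSite P (0 + k)) :
    twistK k g ψ y = (g (siteK k y) : ℂ) * ψ y := rfl

/-- **(6.3.2), closed form**: `S_k(v^g, gψ) = S_k(v, ψ)` with the transformed scalar field `twistK`. [cite: BalabanImbrieJaffe1985, (6.3.2) p.320] -/
theorem meanFieldAction_gaugeIdx_twistK (a : ℝ) (ha : 0 < a) (i : AllIdx d L) (g : TSite i.P i.k → Circle)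
    (ψ : CoarseSpK i.P 0 i.k) :
    meanFieldAction a ha (gaugeIdx i g) (twistK i.k g ψ) = meanFieldAction a ha i ψ :=
  meanFieldAction_gaugeIdx a ha i g (twistK_apply i.k g ψ)

/-- **(6.3.2) with a `U1`-valued gauge transformation** `g : T₁^{(k)} → U1` (the currency of r18's `BIJ85RT33.JointInvariant` / (3.11)
`IsRT311`), acting on the data through the dictionary `Circle ≃ U1` and on the scalar field by `ψ′(y) = g(y)ψ(y)` read in `ℂ` (`toC`).
[cite: BalabanImbrieJaffe1985, (6.3.2) p.320] -/
theorem meanFieldAction_gaugeIdx_U1 (a : ℝ) (ha : 0 < a) (i : AllIdx d L) (g : GaugeTransf i.P i.k U1) {ψ ψ' : CoarseSpK i.P 0 i.k}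
    (hψ' : ∀ y, ψ' y = toC (g (siteK i.k y)) * ψ y) :
    meanFieldAction a ha (gaugeIdx i fun y => circleEquivU1.symm (g y)) ψ' = meanFieldAction a ha i ψ :=
  meanFieldAction_gaugeIdx a ha i _ fun y => by
    rw [hψ' y, ← toC_circleEquivU1 (circleEquivU1.symm (g (siteK i.k y))), MulEquiv.apply_symm_apply]

/-- **(6.3.2) IN PRINT'S LETTERS**: for every gauge function `λ : T₁^{(k)} → ℝ`, with the data transformed by `v ↦ v·e^{−i∂λ}`
(`gaugeIdx_exp_v`; the background then transforms by `u_k ↦ u_ke^{−iη∂(λ∘B^k)}`, `U_gaugeIdx`) and the scalar field by `φ ↦ e^{iλ}φ`: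
`S_k(v·e^{−i∂λ}, e^{iλ}ψ) = S_k(v, ψ)` for the mean field action (4.1) of record. [cite: BalabanImbrieJaffe1985, (6.3.2) p.320] -/
theorem eq632_meanFieldAction (a : ℝ) (ha : 0 < a) (i : AllIdx d L) (lam : TSite i.P i.k → ℝ) {ψ ψ' : CoarseSpK i.P 0 i.k}
    (hψ' : ∀ y, ψ' y = Complex.exp (lam (siteK i.k y) * I) * ψ y) :
    meanFieldAction a ha (gaugeIdx i fun y => Circle.exp (lam y)) ψ' = meanFieldAction a ha i ψ :=
  meanFieldAction_gaugeIdx a ha i _ fun y => by rw [hψ' y, Circle.coe_exp]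

end

end Literature.MathematicalPhysics.QuantumFieldTheory.BalabanImbrieJaffe1984to88.BIJ85Eq632MeanFieldAction
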